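import Mathlib.RingTheory.Valuation.Basic
import Mathlib.Analysis.Normed.Ring.Lemmas
import Mathlib.Tactic
import HarnessLib

/-!
# The Kummer function `f_T = x²y - n(m+n)x³ + n³(2m+n)xy - m²n⁴x² + m²n⁶y` of the Kubert–Tate
# `7`-torsion family takes values of seventh-power valuation wherever `m, n, m - n` are units

PROOF-ONLY file (theorems, no definition, no named fact), topic `NumberTheory/EllipticCurves`; the
`7`-torsion sibling of `KubertTateFiveKummerValuation` (whose structure it follows line by line).
Let `E_{m,n} = kubertTateSeven m n : y² + (n² + mn - m²)xy + m²n³(n - m)y = x³ + m²n(n - m)x²` be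
the integral model of the universal elliptic curve with a point `T = (0,0)` of order `7` (Kubert
1976, Table 3, `N = 7`: `b = d³ - d²`, `c = d² - d`, `d = m/n`, scaled by `u = n⁻²`; tree file
`KubertTateSeven`), over any field `L` with a rank-one valuation `w : L → ℝ≥0` for which `m`, `n`
and `m - n` are UNITS (`w m = w n = w (m - n) = 1`). The function

  `f_T(x, y) = x²y - n(m+n)x³ + n³(2m+n)xy - m²n⁴x² + m²n⁶y`

is the Kummer function of the `φ̂`-descent for `φ : E → E/⟨T⟩` (divisor `7(T) - 7(O)`: it lies in
`L(7(O))` with leading term `x²y`, and vanishes to order `7` at `T`; Silverman *AEC* Exercise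
10.1(c), T. Fisher, JEMS 3 (2001) §§1–2) and satisfies on the curve **`f_T · f_{-T} = -x⁷`**,
`f_{-T}(x,y) = f_T(x, -y - (n² + mn - m²)x - m²n³(n - m))` (`kummerFn₇_mul_kummerFn₇_neg`, with the
explicit cofactor `-(x² + n³(2m+n)x + m²n⁶)²` of the cubic equation). By the valuation bookkeeping
of `KubertTateFiveKummerValuation` / `X1ElevenKummerValues` (no group law is used, only the cubic
equation):

* `exists_val_kummerFn₇_eq_pow` — **for every affine point `(x, y) ≠ T` of `E_{m,n}` over `L`
  there is `z ≠ 0` with `w(f_T(x,y)) = w(z)⁷`**: if `w x > 1` then `w(f_T) = w(y/x)⁷`; if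
  `w x = 1` then `f_T`, `f_{-T}` are integral with product a unit; if `w x < 1` the point reduces
  to `T` or to `-T = (0, m²n³(m - n))` and `w(f_T) = w(x)⁷`, resp. `= 1` (`f_T(-T) = m⁴n⁹(m - n)` is
  a unit).
* `kummerFn₇_ne_zero_of_ne` — in particular `f_T(x, y) ≠ 0` off `T`.

Consequence for the `7`-descent (sequel files): at the completions `ℚ_v`, `v ∤ mn(m - n)` —
including `v = 7` and the primes of `m³ - 8m²n + 5mn² + n³` in the tame régime — `7 ∣ ord_v f_T(P)`
for every local point `P ≠ O, T`, so the `φ̂`-Selmer group lies in the span of the primes of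
`mn(m - n)` in `ℚˣ/ℚˣ⁷` (T. Fisher, JEMS 3 (2001), §§1–2: the Selmer groups of the `7`-isogenies of
the Tate normal form in terms of the primes of `λ`).

## References

* [SilvermanAEC2009] J. H. Silverman, *The Arithmetic of Elliptic Curves*, 2nd ed., Exercise
  10.1(c), Thm. X.1.1(c) and its proof (the valuation argument), VII.§2.
* [Fisher2001FiveSevenDescent] T. Fisher, *Some examples of 5 and 7 descent for elliptic curves
  over ℚ*, JEMS 3 (2001) 169–201, §§1–2.
* [Kubert1976] D. S. Kubert, *Universal bounds on the torsion of elliptic curves*, Proc. London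
  Math. Soc. (3) 33 (1976) 193–237, Table 3 (`N = 7`).

## Design

Theorems only, rank-one valuations `Valuation L ℝ≥0` (as in `KubertTateFiveKummerValuation`). The
point is given by its coordinates and the cubic equation; `T = (0,0)` is excluded by
`¬ (x = 0 ∧ y = 0)`. The Kummer function is written out in coordinates throughout (no definition).
-/

open scoped NNReal

namespace Literature.NumberTheory.EllipticCurves

namespace KubertTateSevenKummer

variable {L : Type*} [Field L] (w : Valuation L ℝ≥0) {m n x y : L}

/-- **`f_T · f_{-T} = -x⁷` on `E_{m,n}`**: with
`f_T = x²y - n(m+n)x³ + n³(2m+n)xy - m²n⁴x² + m²n⁶y` and `f_{-T}(x, y) = f_T(x, -y - a₁x - a₃)` (the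
value of `f_T` at `-(x,y)`; `a₁ = n² + mn - m²`, `a₃ = m²n³(n - m)`), the cubic equation
`y² + a₁xy + a₃y = x³ + m²n(n - m)x²` gives `f_T · f_{-T} = -x⁷` (cofactor `-(x² + n³(2m+n)x + m²n⁶)²`).
[cite: SilvermanAEC2009, Exercise 10.1(c)] [cite: Fisher2001FiveSevenDescent, §1] -/
theorem kummerFn₇_mul_kummerFn₇_neg
    (he : y ^ 2 + (n ^ 2 + m * n - m ^ 2) * x * y + m ^ 2 * n ^ 3 * (n - m) * y =
      x ^ 3 + m ^ 2 * n * (n - m) * x ^ 2) :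
    (x ^ 2 * y - n * (m + n) * x ^ 3 + n ^ 3 * (2 * m + n) * x * y - m ^ 2 * n ^ 4 * x ^ 2
        + m ^ 2 * n ^ 6 * y) *
      (x ^ 2 * (-y - (n ^ 2 + m * n - m ^ 2) * x - m ^ 2 * n ^ 3 * (n - m))
        - n * (m + n) * x ^ 3
        + n ^ 3 * (2 * m + n) * x * (-y - (n ^ 2 + m * n - m ^ 2) * x - m ^ 2 * n ^ 3 * (n - m))
        - m ^ 2 * n ^ 4 * x ^ 2
        + m ^ 2 * n ^ 6 * (-y - (n ^ 2 + m * n - m ^ 2) * x - m ^ 2 * n ^ 3 * (n - m))) =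
      -x ^ 7 := by
  linear_combination (-(x ^ 2 + n ^ 3 * (2 * m + n) * x + m ^ 2 * n ^ 6) ^ 2) * he

/-- The cubic equation in factored form: `y · (y + a₁x + a₃) = x² · (x + a₂)`.
[cite: Kubert1976, Table 3 (N = 7)] -/
theorem eqn₇_factored
    (he : y ^ 2 + (n ^ 2 + m * n - m ^ 2) * x * y + m ^ 2 * n ^ 3 * (n - m) * y =
      x ^ 3 + m ^ 2 * n * (n - m) * x ^ 2) :
    y * (y + (n ^ 2 + m * n - m ^ 2) * x + m ^ 2 * n ^ 3 * (n - m)) =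
      x ^ 2 * (x + m ^ 2 * n * (n - m)) := by
  linear_combination he

section Units

variable (hm : w m = 1) (hn : w n = 1) (hmn : w (m - n) = 1)
include hm hn hmn

omit hm hn in
/-- `w (n - m) = 1`. [cite: SilvermanAEC2009, VII.§2] -/
theorem val_n_sub_m : w (n - m) = 1 := by
  rw [← neg_sub, Valuation.map_neg, hmn]

omit hmn in
/-- `w a₁ = w (n² + mn - m²) ≤ 1`. [cite: SilvermanAEC2009, VII.§2] -/
theorem val_a₁_le : w (n ^ 2 + m * n - m ^ 2) ≤ 1 := by
  refine (Valuation.map_sub w _ _).trans (max_le ((Valuation.map_add w _ _).trans (max_le ?_ ?_)) ?_)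
  · rw [map_pow, hn, one_pow]
  · rw [map_mul, hm, hn, one_mul]
  · rw [map_pow, hm, one_pow]

/-- `w a₂ = w (m²n(n - m)) = 1`. [cite: SilvermanAEC2009, VII.§2] -/
theorem val_a₂ : w (m ^ 2 * n * (n - m)) = 1 := by
  rw [map_mul, map_mul, map_pow, hm, hn, val_n_sub_m w hmn, one_pow, one_mul, one_mul]

/-- `w a₃ = w (m²n³(n - m)) = 1`. [cite: SilvermanAEC2009, VII.§2] -/
theorem val_a₃ : w (m ^ 2 * n ^ 3 * (n - m)) = 1 := by
  rw [map_mul, map_mul, map_pow, map_pow, hm, hn, val_n_sub_m w hmn, one_pow, one_pow,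
    one_mul, one_mul]

omit hmn in
/-- `w (n(m + n)) ≤ 1`. [cite: SilvermanAEC2009, VII.§2] -/
theorem val_c₃_le : w (n * (m + n)) ≤ 1 := by
  rw [map_mul, hn, one_mul]
  exact (Valuation.map_add w _ _).trans (max_le hm.le hn.le)

omit hmn in
/-- `w (n³(2m + n)) ≤ 1`. [cite: SilvermanAEC2009, VII.§2] -/
theorem val_c₁₁_le : w (n ^ 3 * (2 * m + n)) ≤ 1 := by
  rw [map_mul, map_pow, hn, one_pow, one_mul]
  refine (Valuation.map_add w _ _).trans (max_le ?_ hn.le)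
  rw [map_mul, hm, mul_one]
  exact (Valuation.map_add w 1 1 |>.trans (by rw [map_one]; exact max_le le_rfl le_rfl) :
    w (1 + 1) ≤ 1) |> fun h => by rw [show (2 : L) = 1 + 1 by norm_num]; exact h

omit hmn in
/-- `w (m²n⁴) = 1`. [cite: SilvermanAEC2009, VII.§2] -/
theorem val_c₂₀ : w (m ^ 2 * n ^ 4) = 1 := by
  rw [map_mul, map_pow, map_pow, hm, hn, one_pow, one_pow, one_mul]

omit hmn in
/-- `w (m²n⁶) = 1`. [cite: SilvermanAEC2009, VII.§2] -/
theorem val_c₀₁ : w (m ^ 2 * n ^ 6) = 1 := by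
  rw [map_mul, map_pow, map_pow, hm, hn, one_pow, one_pow, one_mul]

/-- `f_T(-T) = -m²n⁶ · a₃ = m⁴n⁹(m - n)` is a unit: `w (m²n⁶ · (m²n³(n-m))) = 1`.
[cite: Fisher2001FiveSevenDescent, §1] -/
theorem val_kummerFn₇_negT : w (m ^ 2 * n ^ 6 * (m ^ 2 * n ^ 3 * (n - m))) = 1 := by
  rw [map_mul, val_c₀₁ w hm hn, val_a₃ w hm hn hmn, one_mul]

/-- **Integral points have integral `y`**: `w x ≤ 1 → w y ≤ 1` (if `w y > 1 ≥ w x` the term `y²`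
strictly dominates the equation). [cite: SilvermanAEC2009, VII.§2] -/
theorem val_y_le_one
    (he : y ^ 2 + (n ^ 2 + m * n - m ^ 2) * x * y + m ^ 2 * n ^ 3 * (n - m) * y =
      x ^ 3 + m ^ 2 * n * (n - m) * x ^ 2)
    (hx : w x ≤ 1) : w y ≤ 1 := by
  by_contra hy
  push Not at hy
  have hf := eqn₇_factored he
  -- `w (y + a₁x + a₃) = w y` since the other two terms have valuation `≤ 1 < w y`
  have h2 : w ((n ^ 2 + m * n - m ^ 2) * x + m ^ 2 * n ^ 3 * (n - m)) < w y := by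
    refine lt_of_le_of_lt (Valuation.map_add w _ _) (max_lt ?_ ?_)
    · rw [map_mul]; exact lt_of_le_of_lt (mul_le_one' (val_a₁_le w hm hn) hx) hy
    · rw [val_a₃ w hm hn hmn]; exact hy
  have h3 : w (y + (n ^ 2 + m * n - m ^ 2) * x + m ^ 2 * n ^ 3 * (n - m)) = w y := by
    rw [show y + (n ^ 2 + m * n - m ^ 2) * x + m ^ 2 * n ^ 3 * (n - m) =
      y + ((n ^ 2 + m * n - m ^ 2) * x + m ^ 2 * n ^ 3 * (n - m)) by ring]
    exact Valuation.map_add_eq_of_lt_left w h2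
  -- LHS valuation `w y * w y > 1`, RHS `≤ 1`
  have hL : 1 < w (y * (y + (n ^ 2 + m * n - m ^ 2) * x + m ^ 2 * n ^ 3 * (n - m))) := by
    rw [map_mul, h3]; exact one_lt_mul'' hy hy
  have hR : w (x ^ 2 * (x + m ^ 2 * n * (n - m))) ≤ 1 := by
    rw [map_mul, map_pow]
    exact mul_le_one' (pow_le_one' hx 2) ((Valuation.map_add w _ _).trans
      (max_le hx (val_a₂ w hm hn hmn).le))
  rw [hf] at hL
  exact absurd (hL.trans_le hR) (lt_irrefl 1)

/-- **Non-integral points**: if `w x > 1` then `w y > w x`, `w y · w y = w x ³` and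
`w (f_T(x,y)) = w (y/x)⁷` with `y/x ≠ 0`. [cite: SilvermanAEC2009, Thm. X.1.1(c) (proof) and VII.§2] -/
theorem val_kummerFn₇_of_one_lt
    (he : y ^ 2 + (n ^ 2 + m * n - m ^ 2) * x * y + m ^ 2 * n ^ 3 * (n - m) * y =
      x ^ 3 + m ^ 2 * n * (n - m) * x ^ 2)
    (hx : 1 < w x) :
    y / x ≠ 0 ∧ w (x ^ 2 * y - n * (m + n) * x ^ 3 + n ^ 3 * (2 * m + n) * x * y - m ^ 2 * n ^ 4 * x ^ 2
      + m ^ 2 * n ^ 6 * y) = w (y / x) ^ 7 := by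
  have hx0 : x ≠ 0 := fun h ↦ by rw [h, map_zero] at hx; exact not_lt_zero hx
  have hwx0 : (0 : ℝ≥0) < w x := zero_lt_one.trans hx
  have hf := eqn₇_factored he
  have hxa₂ : w (x + m ^ 2 * n * (n - m)) = w x :=
    Valuation.map_add_eq_of_lt_left w (by rw [val_a₂ w hm hn hmn]; exact hx)
  have hR : w (x ^ 2 * (x + m ^ 2 * n * (n - m))) = w x ^ 3 := by rw [map_mul, map_pow, hxa₂]; ring
  -- `w y > w x`
  have hyx : w x < w y := by
    by_contra hyx
    push Not at hyx
    have hB : w (y + (n ^ 2 + m * n - m ^ 2) * x + m ^ 2 * n ^ 3 * (n - m)) ≤ w x := by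
      refine (Valuation.map_add w _ _).trans (max_le ((Valuation.map_add w _ _).trans
        (max_le hyx ?_)) ?_)
      · rw [map_mul]; exact mul_le_of_le_one_left' (val_a₁_le w hm hn)
      · rw [val_a₃ w hm hn hmn]; exact hx.le
    have hL : w (y * (y + (n ^ 2 + m * n - m ^ 2) * x + m ^ 2 * n ^ 3 * (n - m))) ≤ w x * w x := by
      rw [map_mul]; exact mul_le_mul' hyx hB
    rw [hf, hR] at hL
    have hx2 : (0 : ℝ≥0) < w x ^ 2 := pow_pos hwx0 2
    have : w x ^ 2 * w x ≤ w x ^ 2 * 1 := by rw [mul_one, ← pow_succ, pow_two]; exact hL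
    exact absurd (le_of_mul_le_mul_left this hx2) (not_le.mpr hx)
  have hy0 : y ≠ 0 := fun h ↦ by rw [h, map_zero] at hyx; exact not_lt_zero hyx
  have hwy1 : 1 < w y := hx.trans hyx
  -- `w (y + a₁x + a₃) = w y`, hence `w y * w y = w x ^ 3`
  have hB : w (y + (n ^ 2 + m * n - m ^ 2) * x + m ^ 2 * n ^ 3 * (n - m)) = w y := by
    have hlt : w ((n ^ 2 + m * n - m ^ 2) * x + m ^ 2 * n ^ 3 * (n - m)) < w y := by
      refine lt_of_le_of_lt (Valuation.map_add w _ _) (max_lt ?_ ?_)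
      · rw [map_mul]
        exact lt_of_le_of_lt (mul_le_of_le_one_left' (val_a₁_le w hm hn)) hyx
      · rw [val_a₃ w hm hn hmn]; exact hwy1
    rw [show y + (n ^ 2 + m * n - m ^ 2) * x + m ^ 2 * n ^ 3 * (n - m) =
      y + ((n ^ 2 + m * n - m ^ 2) * x + m ^ 2 * n ^ 3 * (n - m)) by ring]
    exact Valuation.map_add_eq_of_lt_left w hlt
  have hy2 : w y * w y = w x ^ 3 := by rw [← hR, ← hf, map_mul, hB]
  -- the leading term `x²y`
  have hlead : w (x ^ 2 * y - n * (m + n) * x ^ 3 + n ^ 3 * (2 * m + n) * x * y - m ^ 2 * n ^ 4 * x ^ 2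
      + m ^ 2 * n ^ 6 * y) = w x ^ 2 * w y := by
    have hxxy : w x < w x ^ 2 * w y := by
      calc w x = w x * 1 * 1 := by ring
        _ < w x * w x * w y := by
          gcongr
        _ = w x ^ 2 * w y := by ring
    have h1 : w (-(n * (m + n) * x ^ 3) + n ^ 3 * (2 * m + n) * x * y - m ^ 2 * n ^ 4 * x ^ 2
        + m ^ 2 * n ^ 6 * y) < w (x ^ 2 * y) := by
      rw [map_mul, map_pow]
      refine lt_of_le_of_lt (Valuation.map_add w _ _) (max_lt (lt_of_le_of_lt
        (Valuation.map_sub w _ _) (max_lt (lt_of_le_of_lt (Valuation.map_add w _ _)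
          (max_lt ?_ ?_)) ?_)) ?_)
      · rw [Valuation.map_neg, map_mul, map_pow,
          show w x ^ 3 = w x ^ 2 * w x by ring]
        calc w (n * (m + n)) * (w x ^ 2 * w x) ≤ 1 * (w x ^ 2 * w x) := by
              gcongr; exact val_c₃_le w hm hn
          _ = w x ^ 2 * w x := one_mul _
          _ < w x ^ 2 * w y := by gcongr
      · rw [map_mul, map_mul]
        calc w (n ^ 3 * (2 * m + n)) * w x * w y ≤ 1 * w x * w y := by
              gcongr; exact val_c₁₁_le w hm hn
          _ = w x * 1 * w y := by ring
          _ < w x * w x * w y := by gcongr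
          _ = w x ^ 2 * w y := by ring
      · rw [map_mul, val_c₂₀ w hm hn, one_mul, map_pow]
        calc w x ^ 2 = w x ^ 2 * 1 := (mul_one _).symm
          _ < w x ^ 2 * w y := by gcongr
      · rw [map_mul, val_c₀₁ w hm hn, one_mul]
        calc w y = 1 * w y := (one_mul _).symm
          _ < w x ^ 2 * w y := by gcongr; exact one_lt_pow₀ hx two_ne_zero
    rw [show x ^ 2 * y - n * (m + n) * x ^ 3 + n ^ 3 * (2 * m + n) * x * y - m ^ 2 * n ^ 4 * x ^ 2
        + m ^ 2 * n ^ 6 * y = x ^ 2 * y + (-(n * (m + n) * x ^ 3) + n ^ 3 * (2 * m + n) * x * y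
        - m ^ 2 * n ^ 4 * x ^ 2 + m ^ 2 * n ^ 6 * y) by ring,
      Valuation.map_add_eq_of_lt_left w h1, map_mul, map_pow]
  refine ⟨div_ne_zero hy0 hx0, ?_⟩
  rw [hlead, map_div₀]
  have hxne : w x ≠ 0 := ne_of_gt hwx0
  rw [div_pow, eq_div_iff (pow_ne_zero 7 hxne)]
  calc w x ^ 2 * w y * w x ^ 7 = w y * (w x ^ 3) ^ 3 := by ring
    _ = w y * (w y * w y) ^ 3 := by rw [hy2]
    _ = w y ^ 7 := by ring

omit hmn in
/-- `f_T(x, y')` is integral when `w x ≤ 1` and `w y' ≤ 1`. [cite: SilvermanAEC2009, VII.§2] -/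
theorem val_kummerFn₇_le_one {y' : L} (hx : w x ≤ 1) (hy' : w y' ≤ 1) :
    w (x ^ 2 * y' - n * (m + n) * x ^ 3 + n ^ 3 * (2 * m + n) * x * y' - m ^ 2 * n ^ 4 * x ^ 2
      + m ^ 2 * n ^ 6 * y') ≤ 1 := by
  refine (Valuation.map_add w _ _).trans (max_le ((Valuation.map_sub w _ _).trans (max_le
    ((Valuation.map_add w _ _).trans (max_le ((Valuation.map_sub w _ _).trans (max_le ?_ ?_)) ?_))
    ?_)) ?_)
  · rw [map_mul, map_pow]; exact mul_le_one' (pow_le_one' hx 2) hy'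
  · rw [map_mul, map_pow]; exact mul_le_one' (val_c₃_le w hm hn) (pow_le_one' hx 3)
  · rw [map_mul, map_mul]
    exact mul_le_one' (mul_le_one' (val_c₁₁_le w hm hn) hx) hy'
  · rw [map_mul, map_pow, val_c₂₀ w hm hn, one_mul]; exact pow_le_one' hx 2
  · rw [map_mul, val_c₀₁ w hm hn, one_mul]; exact hy'

/-- **Points with `w x = 1`**: `f_T` and `f_{-T}` are integral with product `-x⁷` a unit, so
`w (f_T(x,y)) = 1`. [cite: SilvermanAEC2009, Thm. X.1.1(c) (proof)] -/
theorem val_kummerFn₇_of_eq_one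
    (he : y ^ 2 + (n ^ 2 + m * n - m ^ 2) * x * y + m ^ 2 * n ^ 3 * (n - m) * y =
      x ^ 3 + m ^ 2 * n * (n - m) * x ^ 2)
    (hx : w x = 1) :
    w (x ^ 2 * y - n * (m + n) * x ^ 3 + n ^ 3 * (2 * m + n) * x * y - m ^ 2 * n ^ 4 * x ^ 2
      + m ^ 2 * n ^ 6 * y) = 1 := by
  have hy : w y ≤ 1 := val_y_le_one w hm hn hmn he hx.le
  have hy' : w (-y - (n ^ 2 + m * n - m ^ 2) * x - m ^ 2 * n ^ 3 * (n - m)) ≤ 1 := by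
    refine (Valuation.map_sub w _ _).trans (max_le ((Valuation.map_sub w _ _).trans (max_le ?_ ?_)) ?_)
    · rw [Valuation.map_neg]; exact hy
    · rw [map_mul, hx, mul_one]; exact val_a₁_le w hm hn
    · exact (val_a₃ w hm hn hmn).le
  have h1 := val_kummerFn₇_le_one w hm hn hx.le hy
  have h2 := val_kummerFn₇_le_one w hm hn hx.le hy'
  have hprod := congrArg w (kummerFn₇_mul_kummerFn₇_neg he)
  rw [map_mul, Valuation.map_neg, map_pow, hx, one_pow] at hprod
  -- `a ≤ 1`, `b ≤ 1`, `a * b = 1` in `ℝ≥0` forces `a = 1`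
  by_contra hne
  have hlt := lt_of_le_of_ne h1 hne
  have := mul_lt_one_of_lt_of_le hlt h2
  rw [hprod] at this
  exact lt_irrefl 1 this

/-- **Points reducing to `-T = (0, -a₃)`** (in the variable `y'`): if `w x < 1` and `w (y' + a₃) < 1`
then `f_T(x,y') ≡ -m²n⁶a₃ = m⁴n⁹(m - n)` is a unit: `w (f_T(x,y')) = 1`.
[cite: SilvermanAEC2009, Thm. X.1.1(c) (proof)] -/
theorem val_kummerFn₇_of_lt_one_of_val_add_lt_one {y' : L}
    (hx : w x < 1) (hy : w (y' + m ^ 2 * n ^ 3 * (n - m)) < 1) :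
    w (x ^ 2 * y' - n * (m + n) * x ^ 3 + n ^ 3 * (2 * m + n) * x * y' - m ^ 2 * n ^ 4 * x ^ 2
      + m ^ 2 * n ^ 6 * y') = 1 := by
  have hyle : w y' ≤ 1 := by
    rw [show y' = (y' + m ^ 2 * n ^ 3 * (n - m)) - m ^ 2 * n ^ 3 * (n - m) by ring]
    exact (Valuation.map_sub w _ _).trans (max_le hy.le (val_a₃ w hm hn hmn).le)
  have hsplit : x ^ 2 * y' - n * (m + n) * x ^ 3 + n ^ 3 * (2 * m + n) * x * y' - m ^ 2 * n ^ 4 * x ^ 2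
      + m ^ 2 * n ^ 6 * y' =
      -(m ^ 2 * n ^ 6 * (m ^ 2 * n ^ 3 * (n - m))) +
        (x * (x * y' - n * (m + n) * x ^ 2 + n ^ 3 * (2 * m + n) * y' - m ^ 2 * n ^ 4 * x) +
          m ^ 2 * n ^ 6 * (y' + m ^ 2 * n ^ 3 * (n - m))) := by ring
  have hsmall : w (x * (x * y' - n * (m + n) * x ^ 2 + n ^ 3 * (2 * m + n) * y' - m ^ 2 * n ^ 4 * x) +
      m ^ 2 * n ^ 6 * (y' + m ^ 2 * n ^ 3 * (n - m))) < 1 := by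
    refine lt_of_le_of_lt (Valuation.map_add w _ _) (max_lt ?_ ?_)
    · rw [map_mul]
      refine mul_lt_one_of_lt_of_le hx ?_
      refine (Valuation.map_sub w _ _).trans (max_le ((Valuation.map_add w _ _).trans (max_le
        ((Valuation.map_sub w _ _).trans (max_le ?_ ?_)) ?_)) ?_)
      · rw [map_mul]; exact mul_le_one' hx.le hyle
      · rw [map_mul, map_pow]; exact mul_le_one' (val_c₃_le w hm hn) (pow_le_one' hx.le 2)
      · rw [map_mul]; exact mul_le_one' (val_c₁₁_le w hm hn) hyle
      · rw [map_mul, val_c₂₀ w hm hn, one_mul]; exact hx.le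
    · rw [map_mul, val_c₀₁ w hm hn, one_mul]; exact hy
  rw [hsplit, Valuation.map_add_eq_of_lt_left w (by
      rw [Valuation.map_neg, val_kummerFn₇_negT w hm hn hmn]; exact hsmall),
    Valuation.map_neg, val_kummerFn₇_negT w hm hn hmn]

/-- **Points reducing to `T`**: if `w x < 1` and `w y < 1` then `f_{-T}(x,y)` is a unit and
`w (f_T(x,y)) = w(x)⁷`. [cite: SilvermanAEC2009, Thm. X.1.1(c) (proof)] -/
theorem val_kummerFn₇_of_lt_one_of_lt_one
    (he : y ^ 2 + (n ^ 2 + m * n - m ^ 2) * x * y + m ^ 2 * n ^ 3 * (n - m) * y =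
      x ^ 3 + m ^ 2 * n * (n - m) * x ^ 2)
    (hx : w x < 1) (hy : w y < 1) :
    w (x ^ 2 * y - n * (m + n) * x ^ 3 + n ^ 3 * (2 * m + n) * x * y - m ^ 2 * n ^ 4 * x ^ 2
      + m ^ 2 * n ^ 6 * y) = w x ^ 7 := by
  -- `y' = -y - a₁x - a₃` satisfies `w (y' + a₃) = w (-y - a₁ x) < 1`
  have hy' : w (-y - (n ^ 2 + m * n - m ^ 2) * x - m ^ 2 * n ^ 3 * (n - m) + m ^ 2 * n ^ 3 * (n - m)) <
      1 := by
    rw [sub_add_cancel]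
    refine lt_of_le_of_lt (Valuation.map_sub w _ _) (max_lt ?_ ?_)
    · rw [Valuation.map_neg]; exact hy
    · rw [map_mul, mul_comm]; exact mul_lt_one_of_lt_of_le hx (val_a₁_le w hm hn)
  have hneg := val_kummerFn₇_of_lt_one_of_val_add_lt_one w hm hn hmn hx hy'
  have hprod := congrArg w (kummerFn₇_mul_kummerFn₇_neg he)
  rw [map_mul, hneg, mul_one, Valuation.map_neg, map_pow] at hprod
  exact hprod

/-- **The dichotomy at an integral point with `w x < 1`**: the point reduces to `T` (`w y < 1`) or
to `-T` (`w (y + a₃) < 1`). [cite: SilvermanAEC2009, VII.§2] -/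
theorem val_y_lt_one_or₇
    (he : y ^ 2 + (n ^ 2 + m * n - m ^ 2) * x * y + m ^ 2 * n ^ 3 * (n - m) * y =
      x ^ 3 + m ^ 2 * n * (n - m) * x ^ 2)
    (hx : w x < 1) : w y < 1 ∨ w (y + m ^ 2 * n ^ 3 * (n - m)) < 1 := by
  have hy : w y ≤ 1 := val_y_le_one w hm hn hmn he hx.le
  -- `y (y + a₃) = x² (x + a₂) - a₁ x y` has valuation `< 1`
  have h1 : y * (y + m ^ 2 * n ^ 3 * (n - m)) =
      x * (x * (x + m ^ 2 * n * (n - m)) - (n ^ 2 + m * n - m ^ 2) * y) := by linear_combination he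
  have hsmall : w (y * (y + m ^ 2 * n ^ 3 * (n - m))) < 1 := by
    rw [h1, map_mul]
    refine mul_lt_one_of_lt_of_le hx ((Valuation.map_sub w _ _).trans (max_le ?_ ?_))
    · rw [map_mul]
      exact mul_le_one' hx.le ((Valuation.map_add w _ _).trans (max_le hx.le (val_a₂ w hm hn hmn).le))
    · rw [map_mul]; exact mul_le_one' (val_a₁_le w hm hn) hy
  by_contra hno
  push Not at hno
  obtain ⟨h2, h3⟩ := hno
  have h2' : w y = 1 := le_antisymm hy h2
  rw [map_mul, h2', one_mul] at hsmall
  exact absurd (h3.trans_lt hsmall) (lt_irrefl 1)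

/-- **Main lemma: `w (f_T(P))` is a seventh power for every affine `P ≠ T` on `E_{m,n}`** when
`m, n, m - n` are `w`-units: there is `z ≠ 0` in `L` with
`w (x²y - n(m+n)x³ + n³(2m+n)xy - m²n⁴x² + m²n⁶y) = w(z)⁷`.
[cite: SilvermanAEC2009, Exercise 10.1(c) and Thm. X.1.1(c) (proof)]
[cite: Fisher2001FiveSevenDescent, §2] -/
theorem exists_val_kummerFn₇_eq_pow
    (he : y ^ 2 + (n ^ 2 + m * n - m ^ 2) * x * y + m ^ 2 * n ^ 3 * (n - m) * y =
      x ^ 3 + m ^ 2 * n * (n - m) * x ^ 2)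
    (hT : ¬ (x = 0 ∧ y = 0)) :
    ∃ z : L, z ≠ 0 ∧ w (x ^ 2 * y - n * (m + n) * x ^ 3 + n ^ 3 * (2 * m + n) * x * y
      - m ^ 2 * n ^ 4 * x ^ 2 + m ^ 2 * n ^ 6 * y) = w z ^ 7 := by
  rcases lt_trichotomy (w x) 1 with hx | hx | hx
  · rcases val_y_lt_one_or₇ w hm hn hmn he hx with hy | hy
    · -- reduces to `T`: `x ≠ 0` (else `y = 0` too) and `w f_T = w x ^ 7`
      have hx0 : x ≠ 0 := by
        intro h0
        apply hT
        refine ⟨h0, ?_⟩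
        have h1 : y * (y + m ^ 2 * n ^ 3 * (n - m)) = 0 := by
          have := eqn₇_factored he
          rw [h0] at this
          linear_combination this
        rcases mul_eq_zero.mp h1 with h | h
        · exact h
        · exfalso
          -- `y = -a₃` is a unit, contradicting `w y < 1`
          have hy1 : w y = 1 := by
            rw [show y = -(m ^ 2 * n ^ 3 * (n - m)) by linear_combination h, Valuation.map_neg]
            exact val_a₃ w hm hn hmn
          rw [hy1] at hy
          exact lt_irrefl 1 hy
      exact ⟨x, hx0, val_kummerFn₇_of_lt_one_of_lt_one w hm hn hmn he hx hy⟩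
    · exact ⟨1, one_ne_zero, by
        rw [map_one, one_pow]
        exact val_kummerFn₇_of_lt_one_of_val_add_lt_one w hm hn hmn hx hy⟩
  · exact ⟨1, one_ne_zero, by rw [map_one, one_pow]; exact val_kummerFn₇_of_eq_one w hm hn hmn he hx⟩
  · obtain ⟨hz, h⟩ := val_kummerFn₇_of_one_lt w hm hn hmn he hx
    exact ⟨y / x, hz, h⟩

/-- **`f_T` does not vanish off `T`** (its valuation is `w(z)⁷ ≠ 0`). [cite: SilvermanAEC2009, Exercise 10.1(c)] -/
theorem kummerFn₇_ne_zero_of_ne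
    (he : y ^ 2 + (n ^ 2 + m * n - m ^ 2) * x * y + m ^ 2 * n ^ 3 * (n - m) * y =
      x ^ 3 + m ^ 2 * n * (n - m) * x ^ 2)
    (hT : ¬ (x = 0 ∧ y = 0)) :
    x ^ 2 * y - n * (m + n) * x ^ 3 + n ^ 3 * (2 * m + n) * x * y - m ^ 2 * n ^ 4 * x ^ 2
      + m ^ 2 * n ^ 6 * y ≠ 0 := by
  obtain ⟨z, hz0, hz⟩ := exists_val_kummerFn₇_eq_pow w hm hn hmn he hT
  intro h0
  rw [h0, map_zero] at hz
  exact pow_ne_zero 7 ((map_ne_zero w).mpr hz0) hz.symm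

end Units

end KubertTateSevenKummer

end Literature.NumberTheory.EllipticCurves
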